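import Mathlib.Analysis.SpecialFunctions.Trigonometric.Basic
import Mathlib.Tactic.LinearCombination
import Literature.Probability.LatticeModels.TriangularLattice
import Literature.Probability.Percolation.TriHexagon

/-!
# The `60°` lattice rotation about `(k, k)` acts on jittered sites as the Euclidean rotation

Helper for crux stmt-CriticalPhenomena-7029
(`Summit.CriticalPhenomena.CardyFormulaZ2.Theses.CardyFlipRusso.QuadrupoleSelectionRule`),
line Sketch, stub S3.

The geometric half of the partial-rotation lever (card A). The rotation by `60°` about the site
`(k, k)` of the triangular lattice acts on labels by
`TriHexagon.hexRot k : (x₀, x₁) ↦ (2k - x₁, x₀ + x₁ - k)` and on a jitter vector `ξ ∈ ℝ²` by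
`ξ ↦ (ξ₁/2 - (√3/2) ξ₂, (√3/2) ξ₁ + ξ₂/2)`. In the equilateral embedding `triEmbed`, the jittered
position `triEmbed (hexRot k v) + σ · rot60 ξ` of the rotated site carrying the rotated jitter is
the image of the old jittered position `triEmbed v + σ ξ` under the Euclidean rotation
`z ↦ c + ζ (z - c)` by `60°` about the centre `c = triEmbed (k, k)`, where `ζ = e^{iπ/3}`
(`triEmbed_hexRot_jitter`). The proof is the evaluation `ζ = 1/2 + (√3/2) i` together with the
cyclotomic relation `ζ² = ζ - 1`.
-/

namespace Summit.CriticalPhenomena.CardyFormulaZ2.Theorems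

open Literature.Probability.LatticeModels Literature.Probability.Percolation

/-- `ζ = e^{iπ/3} = 1/2 + (√3/2) i`, as an equality of complex numbers. [folklore] -/
private theorem triZeta_eq_mk : triZeta = ⟨1 / 2, Real.sqrt 3 / 2⟩ := by
  have h : triZeta = Complex.exp (((Real.pi / 3 : ℝ) : ℂ) * Complex.I) := by
    rw [triZeta]; congr 1; push_cast; ring
  apply Complex.ext
  · rw [h, Complex.exp_ofReal_mul_I_re, Real.cos_pi_div_three]
  · rw [h, Complex.exp_ofReal_mul_I_im, Real.sin_pi_div_three]

/-- `ζ² = ζ - 1`: `ζ = e^{iπ/3}` is a primitive sixth root of unity, `ζ² - ζ + 1 = 0`.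
[folklore] -/
private theorem triZeta_sq_eq : triZeta ^ 2 = triZeta - 1 := by
  have h3 : Real.sqrt 3 * Real.sqrt 3 = 3 := Real.mul_self_sqrt (by norm_num)
  apply Complex.ext
  · simp only [sq, Complex.mul_re, triZeta_eq_mk, Complex.sub_re, Complex.one_re]
    nlinarith [h3]
  · simp only [sq, Complex.mul_im, triZeta_eq_mk, Complex.sub_im, Complex.one_im]
    ring

/-- Rotating a jitter vector `ξ ∈ ℝ²` by `60°`, `ξ ↦ (ξ₁/2 - (√3/2) ξ₂, (√3/2) ξ₁ + ξ₂/2)`, is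
multiplication by `ζ = e^{iπ/3}` of `ξ₁ + i ξ₂` in `ℂ`. [folklore] -/
theorem rot60_jitter_eq_triZeta_mul (ξ : ℝ × ℝ) :
    (((ξ.1 / 2 - Real.sqrt 3 / 2 * ξ.2 : ℝ) : ℂ)
        + ((Real.sqrt 3 / 2 * ξ.1 + ξ.2 / 2 : ℝ) : ℂ) * Complex.I)
      = triZeta * ((ξ.1 : ℂ) + (ξ.2 : ℂ) * Complex.I) := by
  apply Complex.ext
  · simp [triZeta_eq_mk]; ring
  · simp [triZeta_eq_mk]; ring

/-- **Stub S3 (card A, geometric half).** For the rotation `hexRot k` by `60°` about the site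
`(k, k)` and the corresponding rotation of jitters
`ξ ↦ (ξ₁/2 - (√3/2) ξ₂, (√3/2) ξ₁ + ξ₂/2)`, the jittered position of the rotated site with the
rotated jitter is the Euclidean rotation by `60°` (multiplication by `ζ = triZeta = e^{iπ/3}`)
about the centre `c_k = triEmbed (k, k)` of the old jittered position:
`triEmbed (hexRot k v) + σ · rot60 ξ = c_k + ζ · (triEmbed v + σ ξ - c_k)`. [folklore] -/
theorem triEmbed_hexRot_jitter (k : ℕ) (σ : ℝ) (v : Site 2) (ξ : ℝ × ℝ) :
    triEmbed (TriHexagon.hexRot k v)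
        + (σ : ℂ) * (((ξ.1 / 2 - Real.sqrt 3 / 2 * ξ.2 : ℝ) : ℂ)
            + ((Real.sqrt 3 / 2 * ξ.1 + ξ.2 / 2 : ℝ) : ℂ) * Complex.I)
      = triEmbed ![(k : ℤ), (k : ℤ)]
        + triZeta * (triEmbed v + (σ : ℂ) * ((ξ.1 : ℂ) + (ξ.2 : ℂ) * Complex.I)
          - triEmbed ![(k : ℤ), (k : ℤ)]) := by
  rw [rot60_jitter_eq_triZeta_mul]
  simp only [triEmbed, TriHexagon.hexRot_apply_zero, TriHexagon.hexRot_apply_one,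
    Matrix.cons_val_zero, Matrix.cons_val_one]
  push_cast
  linear_combination ((k : ℂ) - (v 1 : ℂ)) * triZeta_sq_eq

end Summit.CriticalPhenomena.CardyFormulaZ2.Theorems
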